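import Literature.Computability.Cryptography.WordRAMPrattRepetition
import Literature.Computability.AlgebraicComplexity.PrattEvaluationData
import Literature.Computability.AlgebraicComplexity.TrilinearIdentityTest
import Literature.Computability.Cryptography.WordRAMRandPrefix
import Mathlib.Data.ZMod.Basic
import HarnessLib

/-!
# Pratt's balanced-tripartitioning machine — the value of one repetition

Mathematical glue between the word-RAM program of K. Pratt, STOC 2024, proof of Thm. 1.9
(`Cryptography/WordRAMPrattRepetition`, `WordRAMPrattMain`) and the algebra of the evaluation
(instalment of the proof of `Literature.Computability.AlgebraicComplexity.pratt2024_thm_1_9`):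

* `levN_cast` — the machine's level tables `levN` (sums modulo `2^w`) are the level tables
  `contractLevel` of BCS Prop. 15.26 over `ℤ/2^w`; `contractLevel_congr`;
* `repV_cast`, `repV_cast_form` — **the value of one repetition** `SProg.repV` is, in `ℤ/2^w`,
  `D^{3q}` times the restricted trilinear form `trilinearForm` (`TrilinearIdentityTest`) of the
  4-bit coin values, restricted to the triples `GoodTriple`: blockwise disjoint flat indices whose
  three masks are listed (`pratt_evaluation_identity`, `PrattEvaluationData`);
* `repV_eq_zero_of_forall_not` — no good triple: the value is `0` ("always zero on no instances");
* `repV_ne_zero_of_form_ne_zero` — a non-zero form and `15³ · Ntot³ · D^{3q} < 2^w` (no overflow):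
  the value is non-zero;
* `repV_congr` — the value depends only on the `M - 1` shuffle coins and the `3 Ntot` value coins;
* counting coin vectors: `card_suffix_ge` (the identity test `card_words_trilinearForm_ne_zero` in the
  machine's interleaved indexing), `card_prefix_mul_le` (counting by prefixes, `splitVec`),
  `card_exists_block_ge` (repetitions, `blocksOf`), and the two bounds the final count uses:
  **`card_block_ge`** (good coin blocks of one repetition: shuffle into a good permutation set `G`,
  then a non-vanishing value vector — `(#G/M!)(1 - M²/2^w)(13/16)` of all blocks) and
  **`card_good_ge_two_thirds`** (`θ Q ≥ 2` gives success `≥ 2/3` over `Q` repetitions).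

## References

* K. Pratt, *A stronger connection between the asymptotic rank conjecture and the set cover
  conjecture*, STOC 2024, arXiv:2311.02774, §2 (proof of Thm. 1.9).
* P. Bürgisser, M. Clausen, M. A. Shokrollahi, *Algebraic Complexity Theory*, Springer 1997,
  Prop. 15.26.
* D. E. Knuth, *The Art of Computer Programming* 2, §3.4.2 Algorithm P (the shuffle).
-/

namespace Literature.Computability.AlgebraicComplexity

open Finset Literature.Computability.Cryptography.WordRAM

/-! ## The level tables modulo the word size -/

/-- **The machine's level tables are the level tables over `ℤ/2^w`.** [cite: BurgisserClausenShokrollahi1997, Prop. 15.26] -/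
theorem levN_cast (N R q w : ℕ) (Uc : ℕ → ℕ → ℕ) (x : ℕ → ℕ) :
    ∀ j P A, ((levN N R q w Uc x j P A : ℕ) : ZMod (2 ^ w)) =
      contractLevel N R q (fun i d => (Uc i d : ZMod (2 ^ w))) (fun A => (x A : ZMod (2 ^ w))) j P A
  | 0, P, A => by rw [levN_zero, contractLevel_zero]
  | j + 1, P, A => by
    rw [levN_succ, contractLevel_succ, ZMod.natCast_mod, Nat.cast_sum]
    refine sum_congr rfl fun d _ => ?_
    rw [Nat.cast_mul, levN_cast N R q w Uc x j (P / R) _]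

/-- `contractLevel` depends only on the coefficient table on `[R] × [N]` and on the input on `[N^q]`.
[folklore] -/
theorem contractLevel_congr {S : Type*} [CommSemiring S] {N R q : ℕ} {U U' : ℕ → ℕ → S}
    {x x' : ℕ → S} (hR : 1 ≤ R) (hU : ∀ i d, i < R → d < N → U i d = U' i d)
    (hx : ∀ A, A < N ^ q → x A = x' A) :
    ∀ j, j ≤ q → ∀ P A, A < N ^ (q - j) →
      contractLevel N R q U x j P A = contractLevel N R q U' x' j P A
  | 0, _, P, A, hA => by simpa using hx A (by simpa using hA)
  | j + 1, hj, P, A, hA => by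
    rw [contractLevel_succ, contractLevel_succ]
    refine sum_congr rfl fun d hd => ?_
    rw [mem_range] at hd
    rw [hU _ _ (Nat.mod_lt _ (by omega)) hd, contractLevel_congr hR hU hx j (by omega) (P / R) _ ?_]
    calc d * N ^ (q - (j + 1)) + A < d * N ^ (q - (j + 1)) + N ^ (q - (j + 1)) := by omega
      _ = (d + 1) * N ^ (q - (j + 1)) := by ring
      _ ≤ N * N ^ (q - (j + 1)) := Nat.mul_le_mul_right _ hd
      _ = N ^ (q - j) := by rw [← pow_succ']; congr 1; omega

/-! ## The value of one repetition -/

variable {w : ℕ}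

/-- **The value of one repetition in `ℤ/2^w`**: with coefficient words congruent to integer tables
`UVW 0, UVW 1, UVW 2` decomposing `D³ · T_k^{⊗m}` (`exists_pratt_data`), the triple sum the machine
forms is `(D³)^q · ∑_{a,b,c < Ntot, AllDisjoint} x_a y_b z_c` of the filled values.
[cite: Pratt2024SCC, §2 (proof of Thm. 1.9)] -/
theorem repV_cast (T : RepTables) (Lay : RepLayout) (c v : ℕ → ℕ) {k m D : ℕ}
    (UVW : ℕ → ℕ → ℕ → ℤ) (hN : Lay.N = prattC k ^ m) (hR : 1 ≤ Lay.R)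
    (hUc : ∀ l i d, l < 3 → i < Lay.R → d < Lay.N →
      (T.Uc l i d : ZMod (2 ^ w)) = (UVW l i d : ZMod (2 ^ w)))
    (hdec : ∀ d e f, ∑ i ∈ range Lay.R, UVW 0 i d * UVW 1 i e * UVW 2 i f =
      if ∀ t, t < m → DigitDisjoint k t d e f then (D : ℤ) ^ 3 else 0) :
    (SProg.repV w T Lay c v : ZMod (2 ^ w)) = ((D : ZMod (2 ^ w)) ^ 3) ^ Lay.q *
      ∑ a ∈ range Lay.Ntot, ∑ b ∈ range Lay.Ntot, ∑ c' ∈ range Lay.Ntot,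
        if AllDisjoint k (Lay.q * m) a b c' then
          (SProg.xOf T (SProg.gOf Lay.M c) Lay v 0 a : ZMod (2 ^ w)) *
            (SProg.xOf T (SProg.gOf Lay.M c) Lay v 1 b : ZMod (2 ^ w)) *
            (SProg.xOf T (SProg.gOf Lay.M c) Lay v 2 c' : ZMod (2 ^ w)) else 0 := by
  have key := pratt_evaluation_identity (S := ZMod (2 ^ w)) k m Lay.q Lay.R D (UVW 0) (UVW 1) (UVW 2)
    hdec (fun a => (SProg.xOf T (SProg.gOf Lay.M c) Lay v 0 a : ZMod (2 ^ w)))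
    (fun a => (SProg.xOf T (SProg.gOf Lay.M c) Lay v 1 a : ZMod (2 ^ w)))
    (fun a => (SProg.xOf T (SProg.gOf Lay.M c) Lay v 2 a : ZMod (2 ^ w)))
  rw [← hN] at key
  have hc : ∀ l, l < 3 → ∀ (x : ℕ → ZMod (2 ^ w)) (P : ℕ),
      contractLevel Lay.N Lay.R Lay.q (fun i d => (T.Uc l i d : ZMod (2 ^ w))) x Lay.q P 0 =
      contractLevel Lay.N Lay.R Lay.q (fun i d => (UVW l i d : ZMod (2 ^ w))) x Lay.q P 0 :=
    fun l hl x P => contractLevel_congr hR (fun i d hi hd => hUc l i d hl hi hd) (fun A _ => rfl)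
      Lay.q le_rfl P 0 (by rw [Nat.sub_self, pow_zero]; exact Nat.one_pos)
  unfold SProg.repV SProg.levOf RepLayout.Ntot
  rw [ZMod.natCast_mod, Nat.cast_sum, ← key]
  refine sum_congr rfl fun P _ => ?_
  rw [Nat.cast_mul, Nat.cast_mul, levN_cast, levN_cast, levN_cast, hc 0 (by omega), hc 1 (by omega),
    hc 2 (by omega)]

/-- The membership bit of leg `l` at flat index `a` under the permutation array `g`: is the mask
of the relabelled block-balanced set listed in family `l`? [cite: Pratt2024SCC, §2 (proof of Thm. 1.9)] -/
def membOf (T : RepTables) (Lay : RepLayout) (g : ℕ → ℕ) (l a : ℕ) : ℕ :=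
  T.Ft l (SProg.maskOf T.BM g Lay.tk Lay.C Lay.r a)

/-- The 4-bit value of leg `l` at flat index `a` from the value coins `v`. [cite: Pratt2024SCC, §2 (proof of Thm. 1.9)] -/
def valOf (v : ℕ → ℕ) (l a : ℕ) : ℤ := ((v (3 * a + l) % 16 : ℕ) : ℤ)

/-- The filled value is membership bit times coin value. [folklore] -/
theorem xOf_eq (T : RepTables) (Lay : RepLayout) (g v : ℕ → ℕ) (l a : ℕ) :
    (SProg.xOf T g Lay v l a : ℤ) = membOf T Lay g l a * valOf v l a := by
  unfold SProg.xOf membOf valOf; push_cast; ring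

/-- Values are in `[0, 15]`. [folklore] -/
theorem abs_valOf_le (v : ℕ → ℕ) (l a : ℕ) : |valOf v l a| ≤ 15 := by
  unfold valOf
  rw [abs_of_nonneg (by positivity)]
  have := Nat.mod_lt (v (3 * a + l)) (show 0 < 16 by norm_num)
  exact_mod_cast (by omega : v (3 * a + l) % 16 ≤ 15)

/-- **The good triples of a repetition**: blockwise disjoint flat indices `a, b, c` whose masks under
`g` are listed in families `0, 1, 2`. [cite: Pratt2024SCC, §2 (proof of Thm. 1.9)] -/
def GoodTriple (k : ℕ) (T : RepTables) (Lay : RepLayout) (g : ℕ → ℕ) (a b c : ℕ) : Prop :=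
  AllDisjoint k Lay.r a b c ∧ membOf T Lay g 0 a = 1 ∧ membOf T Lay g 1 b = 1 ∧ membOf T Lay g 2 c = 1

/-- Good triples are decidable. [folklore] -/
noncomputable instance (k : ℕ) (T : RepTables) (Lay : RepLayout) (g : ℕ → ℕ) (a b c : ℕ) :
    Decidable (GoodTriple k T Lay g a b c) := by
  unfold GoodTriple; infer_instance

/-- With `0/1` membership bits, the restricted triple sum of the filled values is the trilinear form
restricted to the good triples. [cite: Pratt2024SCC, §2 (proof of Thm. 1.9)] -/
theorem sum_ite_xOf_eq_trilinearForm (k : ℕ) (T : RepTables) (Lay : RepLayout) (g v : ℕ → ℕ)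
    (hm1 : ∀ l a, l < 3 → membOf T Lay g l a ≤ 1) :
    ∑ a ∈ range Lay.Ntot, ∑ b ∈ range Lay.Ntot, ∑ c ∈ range Lay.Ntot,
      (if AllDisjoint k Lay.r a b c then
        (SProg.xOf T g Lay v 0 a : ℤ) * (SProg.xOf T g Lay v 1 b : ℤ) * (SProg.xOf T g Lay v 2 c : ℤ) else 0) =
    trilinearForm Lay.Ntot (GoodTriple k T Lay g) (valOf v 0) (valOf v 1) (valOf v 2) := by
  unfold trilinearForm
  refine sum_congr rfl fun a _ => sum_congr rfl fun b _ => sum_congr rfl fun c _ => ?_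
  unfold GoodTriple
  by_cases hA : AllDisjoint k Lay.r a b c
  · rw [if_pos hA, xOf_eq, xOf_eq, xOf_eq]
    have h0 := hm1 0 a (by norm_num)
    have h1 := hm1 1 b (by norm_num)
    have h2 := hm1 2 c (by norm_num)
    by_cases e0 : membOf T Lay g 0 a = 1
    · by_cases e1 : membOf T Lay g 1 b = 1
      · by_cases e2 : membOf T Lay g 2 c = 1
        · rw [if_pos ⟨hA, e0, e1, e2⟩, e0, e1, e2]; push_cast; ring
        · have : membOf T Lay g 2 c = 0 := by omega
          rw [if_neg (fun h => e2 h.2.2.2), this]; push_cast; ring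
      · have : membOf T Lay g 1 b = 0 := by omega
        rw [if_neg (fun h => e1 h.2.2.1), this]; push_cast; ring
    · have : membOf T Lay g 0 a = 0 := by omega
      rw [if_neg (fun h => e0 h.2.1), this]; push_cast; ring
  · rw [if_neg hA, if_neg (fun h => hA h.1)]

/-- **The value of one repetition is `D^{3q}` times the restricted trilinear form of the coin values**
(in `ℤ/2^w`). [cite: Pratt2024SCC, §2 (proof of Thm. 1.9)] -/
theorem repV_cast_form (T : RepTables) (Lay : RepLayout) (c v : ℕ → ℕ) {k m D : ℕ}
    (UVW : ℕ → ℕ → ℕ → ℤ) (hN : Lay.N = prattC k ^ m) (hR : 1 ≤ Lay.R) (hr : Lay.r = Lay.q * m)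
    (hUc : ∀ l i d, l < 3 → i < Lay.R → d < Lay.N →
      (T.Uc l i d : ZMod (2 ^ w)) = (UVW l i d : ZMod (2 ^ w)))
    (hdec : ∀ d e f, ∑ i ∈ range Lay.R, UVW 0 i d * UVW 1 i e * UVW 2 i f =
      if ∀ t, t < m → DigitDisjoint k t d e f then (D : ℤ) ^ 3 else 0)
    (hm1 : ∀ l a, l < 3 → membOf T Lay (SProg.gOf Lay.M c) l a ≤ 1) :
    (SProg.repV w T Lay c v : ZMod (2 ^ w)) =
      ((((D : ℤ) ^ 3) ^ Lay.q * trilinearForm Lay.Ntot (GoodTriple k T Lay (SProg.gOf Lay.M c))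
        (valOf v 0) (valOf v 1) (valOf v 2) : ℤ) : ZMod (2 ^ w)) := by
  rw [repV_cast T Lay c v UVW hN hR hUc hdec, show Lay.q * m = Lay.r from hr.symm, Int.cast_mul]
  congr 1
  · push_cast; rfl
  · rw [← sum_ite_xOf_eq_trilinearForm k T Lay _ v hm1]
    push_cast
    rfl

/-- The value is a word. [folklore] -/
theorem repV_lt (T : RepTables) (Lay : RepLayout) (c v : ℕ → ℕ) : SProg.repV w T Lay c v < 2 ^ w :=
  Nat.mod_lt _ (Nat.two_pow_pos w)

/-- **No good triple: the value is zero** ("always zero on no instances"). [cite: Pratt2024SCC, §2 (proof of Thm. 1.9)] -/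
theorem repV_eq_zero_of_forall_not (T : RepTables) (Lay : RepLayout) (c v : ℕ → ℕ) {k m D : ℕ}
    (UVW : ℕ → ℕ → ℕ → ℤ) (hN : Lay.N = prattC k ^ m) (hR : 1 ≤ Lay.R) (hr : Lay.r = Lay.q * m)
    (hUc : ∀ l i d, l < 3 → i < Lay.R → d < Lay.N →
      (T.Uc l i d : ZMod (2 ^ w)) = (UVW l i d : ZMod (2 ^ w)))
    (hdec : ∀ d e f, ∑ i ∈ range Lay.R, UVW 0 i d * UVW 1 i e * UVW 2 i f =
      if ∀ t, t < m → DigitDisjoint k t d e f then (D : ℤ) ^ 3 else 0)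
    (hm1 : ∀ l a, l < 3 → membOf T Lay (SProg.gOf Lay.M c) l a ≤ 1)
    (h : ∀ a b c', a < Lay.Ntot → b < Lay.Ntot → c' < Lay.Ntot → ¬ GoodTriple k T Lay (SProg.gOf Lay.M c) a b c') :
    SProg.repV w T Lay c v = 0 := by
  have hcast := repV_cast_form T Lay c v UVW hN hR hr hUc hdec hm1
  rw [trilinearForm_eq_zero_of_forall_not _ _ h, mul_zero, Int.cast_zero, ZMod.natCast_eq_zero_iff] at hcast
  exact Nat.eq_zero_of_dvd_of_lt hcast (repV_lt T Lay c v)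

/-- **A non-zero form without overflow: the value is non-zero.** [cite: Pratt2024SCC, §2 (proof of Thm. 1.9)] -/
theorem repV_ne_zero_of_form_ne_zero (T : RepTables) (Lay : RepLayout) (c v : ℕ → ℕ) {k m D : ℕ}
    (UVW : ℕ → ℕ → ℕ → ℤ) (hN : Lay.N = prattC k ^ m) (hR : 1 ≤ Lay.R) (hr : Lay.r = Lay.q * m)
    (hUc : ∀ l i d, l < 3 → i < Lay.R → d < Lay.N →
      (T.Uc l i d : ZMod (2 ^ w)) = (UVW l i d : ZMod (2 ^ w)))
    (hdec : ∀ d e f, ∑ i ∈ range Lay.R, UVW 0 i d * UVW 1 i e * UVW 2 i f =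
      if ∀ t, t < m → DigitDisjoint k t d e f then (D : ℤ) ^ 3 else 0)
    (hm1 : ∀ l a, l < 3 → membOf T Lay (SProg.gOf Lay.M c) l a ≤ 1) (hD : 0 < D)
    (hform : trilinearForm Lay.Ntot (GoodTriple k T Lay (SProg.gOf Lay.M c)) (valOf v 0) (valOf v 1) (valOf v 2) ≠ 0)
    (hfit : 15 ^ 3 * Lay.Ntot ^ 3 * (D ^ 3) ^ Lay.q < 2 ^ w) : SProg.repV w T Lay c v ≠ 0 := by
  intro h0
  have hcast := repV_cast_form T Lay c v UVW hN hR hr hUc hdec hm1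
  rw [h0, Nat.cast_zero] at hcast
  set Z : ℤ := ((D : ℤ) ^ 3) ^ Lay.q * trilinearForm Lay.Ntot (GoodTriple k T Lay (SProg.gOf Lay.M c))
    (valOf v 0) (valOf v 1) (valOf v 2) with hZ
  have hdvd : ((2 ^ w : ℕ) : ℤ) ∣ Z := (ZMod.intCast_zmod_eq_zero_iff_dvd Z (2 ^ w)).1 hcast.symm
  have hZ0 : Z ≠ 0 := mul_ne_zero (pow_ne_zero _ (pow_ne_zero _ (by exact_mod_cast hD.ne'))) hform
  have htf : |trilinearForm Lay.Ntot (GoodTriple k T Lay (SProg.gOf Lay.M c)) (valOf v 0) (valOf v 1) (valOf v 2)| ≤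
      (Lay.Ntot : ℤ) ^ 3 * 15 ^ 3 := by
    unfold trilinearForm
    exact abs_sum_ite_mul_le Lay.Ntot _ (valOf v 0) (valOf v 1) (valOf v 2) (abs_valOf_le v 0) (abs_valOf_le v 1)
      (abs_valOf_le v 2)
  have habs : |Z| < 2 ^ w := by
    rw [hZ, abs_mul, abs_of_nonneg (by positivity : (0 : ℤ) ≤ ((D : ℤ) ^ 3) ^ Lay.q)]
    have hfit' : ((15 ^ 3 * Lay.Ntot ^ 3 * (D ^ 3) ^ Lay.q : ℕ) : ℤ) < ((2 ^ w : ℕ) : ℤ) := by exact_mod_cast hfit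
    push_cast at hfit'
    calc ((D : ℤ) ^ 3) ^ Lay.q * |trilinearForm Lay.Ntot (GoodTriple k T Lay (SProg.gOf Lay.M c)) (valOf v 0) (valOf v 1)
          (valOf v 2)| ≤ ((D : ℤ) ^ 3) ^ Lay.q * ((Lay.Ntot : ℤ) ^ 3 * 15 ^ 3) :=
          mul_le_mul_of_nonneg_left htf (by positivity)
      _ = 15 ^ 3 * (Lay.Ntot : ℤ) ^ 3 * ((D : ℤ) ^ 3) ^ Lay.q := by ring
      _ < 2 ^ w := hfit'
  have hle : ((2 ^ w : ℕ) : ℤ) ≤ |Z| := Int.le_of_dvd (abs_pos.2 hZ0) ((dvd_abs _ _).2 hdvd)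
  push_cast at hle
  omega

/-- **The value of a repetition reads `M - 1` shuffle coins and `3 Ntot` value coins only.** [folklore] -/
theorem repV_congr (T : RepTables) (Lay : RepLayout) {c c' v v' : ℕ → ℕ} (hR : 1 ≤ Lay.R)
    (hc : ∀ t, t < Lay.M - 1 → c t = c' t) (hv : ∀ t, t < 3 * Lay.Ntot → v t = v' t) :
    SProg.repV w T Lay c v = SProg.repV w T Lay c' v' := by
  have hfy : Literature.Combinatorics.Enumerative.fisherYates Lay.M c =
      Literature.Combinatorics.Enumerative.fisherYates Lay.M c' := by
    unfold Literature.Combinatorics.Enumerative.fisherYates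
    exact Literature.Combinatorics.Enumerative.swapProd_congr fun i _ hi => by rw [hc i (by omega)]
  have hg : SProg.gOf Lay.M c = SProg.gOf Lay.M c' := by
    funext p; unfold SProg.gOf; rw [hfy]
  have hx : ∀ l, l < 3 → ∀ A, A < Lay.N ^ Lay.q →
      SProg.xOf T (SProg.gOf Lay.M c) Lay v l A = SProg.xOf T (SProg.gOf Lay.M c') Lay v' l A := by
    intro l hl A hA
    unfold SProg.xOf
    rw [hg, hv (3 * A + l) (by unfold RepLayout.Ntot; omega)]
  unfold SProg.repV SProg.levOf
  congr 1
  refine sum_congr rfl fun P _ => ?_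
  rw [SProg.levN_congr hR (fun _ _ _ _ => rfl) (hx 0 (by norm_num)) Lay.q le_rfl P 0 (by simp),
    SProg.levN_congr hR (fun _ _ _ _ => rfl) (hx 1 (by norm_num)) Lay.q le_rfl P 0 (by simp),
    SProg.levN_congr hR (fun _ _ _ _ => rfl) (hx 2 (by norm_num)) Lay.q le_rfl P 0 (by simp)]

/-- Membership bits are `0/1` when the tables are and `g` is a permutation of `[M]`, `M = r · tk`.
[folklore] -/
theorem membOf_le_one {T : RepTables} {Lay : RepLayout} {g : ℕ → ℕ} {M : ℕ}
    (hFt1 : ∀ l a, l < 3 → a < Lay.MB → T.Ft l a ≤ 1) (hMB : Lay.MB = 2 ^ M)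
    (hgM : ∀ p, p < M → g p < M) (hginj : ∀ p p', p < M → p' < M → g p = g p' → p = p')
    (hrtk : Lay.r * Lay.tk = M) (hC : 1 ≤ Lay.C) (hBM1 : ∀ j i, j < Lay.C → i < Lay.tk → T.BM j i ≤ 1)
    {l : ℕ} (hl : l < 3) (a : ℕ) : membOf T Lay g l a ≤ 1 :=
  hFt1 l _ hl (by rw [hMB]; exact SProg.maskOf_lt hgM hginj hrtk (by omega) hBM1 a)


/-! ## Counting coin vectors

The coin block of one repetition is `β : Fin coins → [2^w]`, `coins = (M - 1) + 3 Ntot`: the shuffle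
reads the first `M - 1` words, the fill reads the next `3 Ntot`. All counts below are over the uniform
distribution on such vectors (`successProb` counts coin vectors). -/

section Counting

open Literature.Combinatorics.Enumerative

/-- The trilinear form depends only on the values below `Nt`. [folklore] -/
theorem trilinearForm_congr (Nt : ℕ) (Good : ℕ → ℕ → ℕ → Prop) [∀ a b c, Decidable (Good a b c)]
    {ξ ξ' η η' ζ ζ' : ℕ → ℤ} (h1 : ∀ a, a < Nt → ξ a = ξ' a) (h2 : ∀ a, a < Nt → η a = η' a)
    (h3 : ∀ a, a < Nt → ζ a = ζ' a) :
    trilinearForm Nt Good ξ η ζ = trilinearForm Nt Good ξ' η' ζ' := by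
  unfold trilinearForm
  refine sum_congr rfl fun a ha => sum_congr rfl fun b hb => sum_congr rfl fun c hc => ?_
  rw [mem_range] at ha hb hc
  rw [h1 a ha, h2 b hb, h3 c hc]

/-- The re-indexing `a + Nt · l ↦ 3 a + l` of the `3 Nt` value variables (the identity test numbers
the variables leg-major, the machine interleaves them). [folklore] -/
def interleave (Nt : ℕ) : Fin (3 * Nt) ≃ Fin (3 * Nt) :=
  finProdFinEquiv.symm.trans (((Equiv.prodComm (Fin 3) (Fin Nt)).trans finProdFinEquiv).trans
    (finCongr (Nat.mul_comm Nt 3)))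

/-- `interleave (varIdx l a) = 3 a + l`. [folklore] -/
theorem interleave_varIdx (Nt : ℕ) (l : Fin 3) (a : Fin Nt) :
    ((interleave Nt (varIdx Nt l a) : Fin (3 * Nt)) : ℕ) = 3 * a + l := by
  unfold interleave varIdx
  simp only [Equiv.trans_apply, Equiv.symm_apply_apply, Equiv.prodComm_apply, Prod.swap_prod_mk,
    finProdFinEquiv_apply_val, finCongr_apply, Fin.val_cast]
  ring

/-- **The suffix count**: with a good triple and `w ≥ 4`, at least `13/16` of the value-coin vectors
`σ ∈ [2^w]^{3 Nt}` make the form of the machine's values non-zero (`card_words_trilinearForm_ne_zero`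
re-indexed). [cite: Pratt2024SCC, §2 (proof of Thm. 1.9)] -/
theorem card_suffix_ge (Nt : ℕ) (Good : ℕ → ℕ → ℕ → Prop) [∀ a b c, Decidable (Good a b c)]
    {a₀ b₀ c₀ : ℕ} (ha : a₀ < Nt) (hb : b₀ < Nt) (hc : c₀ < Nt) (hg : Good a₀ b₀ c₀) (hw : 4 ≤ w) :
    13 * (2 ^ w) ^ (3 * Nt) ≤ 16 * #{σ : Fin (3 * Nt) → Fin (2 ^ w) |
      trilinearForm Nt Good (valOf (coinBlockStream σ) 0) (valOf (coinBlockStream σ) 1)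
        (valOf (coinBlockStream σ) 2) ≠ 0} := by
  classical
  have h := card_words_trilinearForm_ne_zero Nt Good ha hb hc hg hw
  set e : (Fin (3 * Nt) → Fin (2 ^ w)) ≃ (Fin (3 * Nt) → Fin (2 ^ w)) :=
    Equiv.arrowCongr (interleave Nt).symm (Equiv.refl _) with he
  have hval : ∀ (σ : Fin (3 * Nt) → Fin (2 ^ w)) (l : Fin 3) (a : ℕ), a < Nt →
      valOf (coinBlockStream σ) l a = readVar Nt (wordValues (e σ)) l a := by
    intro σ l a ha'
    rw [show a = ((⟨a, ha'⟩ : Fin Nt) : ℕ) from rfl, readVar_of_lt]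
    show valOf (coinBlockStream σ) l a = (((σ (interleave Nt (varIdx Nt l ⟨a, ha'⟩)) : ℕ) % 16 : ℕ) : ℤ)
    unfold valOf coinBlockStream
    have hlt : 3 * a + l < 3 * Nt := by have := l.2; omega
    rw [dif_pos hlt]
    congr 3
    exact congrArg _ (Fin.ext (by rw [interleave_varIdx]))
  have hval0 : ∀ (σ : Fin (3 * Nt) → Fin (2 ^ w)) (a : ℕ), a < Nt →
      valOf (coinBlockStream σ) 0 a = readVar Nt (wordValues (e σ)) 0 a := fun σ a ha' => hval σ 0 a ha'
  have hval1 : ∀ (σ : Fin (3 * Nt) → Fin (2 ^ w)) (a : ℕ), a < Nt →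
      valOf (coinBlockStream σ) 1 a = readVar Nt (wordValues (e σ)) 1 a := fun σ a ha' => hval σ 1 a ha'
  have hval2 : ∀ (σ : Fin (3 * Nt) → Fin (2 ^ w)) (a : ℕ), a < Nt →
      valOf (coinBlockStream σ) 2 a = readVar Nt (wordValues (e σ)) 2 a := fun σ a ha' => hval σ 2 a ha'
  have hcard : #{σ : Fin (3 * Nt) → Fin (2 ^ w) |
      trilinearForm Nt Good (valOf (coinBlockStream σ) 0) (valOf (coinBlockStream σ) 1)
        (valOf (coinBlockStream σ) 2) ≠ 0} = #{c : Fin (3 * Nt) → Fin (2 ^ w) |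
      trilinearForm Nt Good (readVar Nt (wordValues c) 0) (readVar Nt (wordValues c) 1)
        (readVar Nt (wordValues c) 2) ≠ 0} := by
    refine Finset.card_equiv e fun σ => ?_
    simp only [mem_filter, mem_univ, true_and]
    rw [trilinearForm_congr Nt Good (hval0 σ) (hval1 σ) (hval2 σ)]
  rw [hcard]; exact h

/-! ### Prefix and suffix -/

/-- Splitting a word vector of length `m + n` into its prefix and suffix. [folklore] -/
def splitVec (m n K : ℕ) : (Fin (m + n) → Fin K) ≃ (Fin m → Fin K) × (Fin n → Fin K) :=
  ((Equiv.arrowCongr finSumFinEquiv (Equiv.refl (Fin K))).symm).trans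
    (Equiv.sumArrowEquivProdArrow (Fin m) (Fin n) (Fin K))

/-- The prefix. [folklore] -/
theorem splitVec_fst {m n K : ℕ} (β : Fin (m + n) → Fin K) (i : Fin m) :
    (splitVec m n K β).1 i = β (Fin.castAdd n i) := by
  simp [splitVec, Equiv.sumArrowEquivProdArrow_apply_fst]

/-- The suffix. [folklore] -/
theorem splitVec_snd {m n K : ℕ} (β : Fin (m + n) → Fin K) (j : Fin n) :
    (splitVec m n K β).2 j = β (Fin.natAdd m j) := by
  simp [splitVec, Equiv.sumArrowEquivProdArrow_apply_snd]

/-- The stream of the prefix. [folklore] -/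
theorem coinBlockStream_split_fst {m n K : ℕ} (β : Fin (m + n) → Fin K) {t : ℕ} (ht : t < m) :
    coinBlockStream β t = coinBlockStream (splitVec m n K β).1 t := by
  unfold coinBlockStream
  rw [dif_pos (by omega), dif_pos ht, splitVec_fst]; rfl

/-- The stream of the suffix. [folklore] -/
theorem coinBlockStream_split_snd {m n K : ℕ} (β : Fin (m + n) → Fin K) {t : ℕ} (ht : t < n) :
    coinBlockStream β (m + t) = coinBlockStream (splitVec m n K β).2 t := by
  unfold coinBlockStream
  rw [dif_pos (by omega), dif_pos ht, splitVec_snd]; rfl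

/-- **Counting by prefixes**: if `P β` follows from `A (prefix β)` and `B (prefix β) (suffix β)`, and for
every prefix with `A` at least `b / d` suffixes have `B`, then `#{A} · b ≤ d · #{P}`. [folklore] -/
theorem card_prefix_mul_le {m n K : ℕ} {P : (Fin (m + n) → Fin K) → Prop} [DecidablePred P]
    {A : (Fin m → Fin K) → Prop} [DecidablePred A] {B : (Fin m → Fin K) → (Fin n → Fin K) → Prop}
    [∀ ρ, DecidablePred (B ρ)]
    (hP : ∀ β, A (splitVec m n K β).1 → B (splitVec m n K β).1 (splitVec m n K β).2 → P β) {b d : ℕ}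
    (hB : ∀ ρ, A ρ → b ≤ d * #{σ : Fin n → Fin K | B ρ σ}) :
    #{ρ : Fin m → Fin K | A ρ} * b ≤ d * #{β : Fin (m + n) → Fin K | P β} := by
  classical
  set e := splitVec m n K with he
  let emb : (Fin m → Fin K) → ((Fin n → Fin K) ↪ (Fin (m + n) → Fin K)) := fun ρ =>
    ⟨fun σ => e.symm (ρ, σ), fun σ σ' h => by
      have := congrArg (fun β => (e β).2) h
      simpa using this⟩
  have hemb : ∀ ρ σ, emb ρ σ = e.symm (ρ, σ) := fun _ _ => rfl
  have hdisj : ∀ ρ ∈ ({ρ : Fin m → Fin K | A ρ} : Finset _), ∀ ρ' ∈ ({ρ : Fin m → Fin K | A ρ} : Finset _),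
      ρ ≠ ρ' → Disjoint (({σ : Fin n → Fin K | B ρ σ} : Finset _).map (emb ρ))
        (({σ : Fin n → Fin K | B ρ' σ} : Finset _).map (emb ρ')) := by
    intro ρ _ ρ' _ hne
    rw [Finset.disjoint_left]
    intro β h1 h2
    rw [mem_map] at h1 h2
    obtain ⟨σ, _, rfl⟩ := h1
    obtain ⟨σ', _, h⟩ := h2
    rw [hemb, hemb] at h
    have := congrArg (fun β => (e β).1) h
    simp only [Equiv.apply_symm_apply] at this
    exact hne this.symm
  have hcover : ({ρ : Fin m → Fin K | A ρ} : Finset _).biUnion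
      (fun ρ => ({σ : Fin n → Fin K | B ρ σ} : Finset _).map (emb ρ)) ⊆ ({β : Fin (m + n) → Fin K | P β} : Finset _) := by
    intro β hβ
    rw [mem_biUnion] at hβ
    obtain ⟨ρ, hρ, hβ⟩ := hβ
    rw [mem_map] at hβ
    obtain ⟨σ, hσ, rfl⟩ := hβ
    rw [mem_filter] at hρ hσ ⊢
    refine ⟨mem_univ _, ?_⟩
    have h1 : e (emb ρ σ) = (ρ, σ) := by rw [hemb]; exact e.apply_symm_apply _
    refine hP _ ?_ ?_
    · rw [h1]; exact hρ.2
    · rw [h1]; exact hσ.2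
  calc #{ρ : Fin m → Fin K | A ρ} * b = ∑ _ρ ∈ ({ρ : Fin m → Fin K | A ρ} : Finset _), b := by
        rw [sum_const, smul_eq_mul]
    _ ≤ ∑ ρ ∈ ({ρ : Fin m → Fin K | A ρ} : Finset _), d * #(({σ : Fin n → Fin K | B ρ σ} : Finset _).map (emb ρ)) :=
        sum_le_sum fun ρ hρ => by rw [card_map]; exact hB ρ (mem_filter.1 hρ).2
    _ = d * #(({ρ : Fin m → Fin K | A ρ} : Finset _).biUnion
          fun ρ => ({σ : Fin n → Fin K | B ρ σ} : Finset _).map (emb ρ)) := by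
        rw [← mul_sum, card_biUnion hdisj]
    _ ≤ d * #{β : Fin (m + n) → Fin K | P β} := Nat.mul_le_mul_left _ (card_le_card hcover)

/-! ### Blocks of repetitions -/

/-- Cutting a coin vector of `Q · n` words into its `Q` blocks. [folklore] -/
def blocksOf (Q n K : ℕ) : (Fin (Q * n) → Fin K) ≃ (Fin Q → Fin n → Fin K) :=
  ((Equiv.arrowCongr finProdFinEquiv (Equiv.refl (Fin K))).symm).trans (Equiv.curry (Fin Q) (Fin n) (Fin K))

/-- Reading a block. [folklore] -/
theorem blocksOf_apply {Q n K : ℕ} (c : Fin (Q * n) → Fin K) (j : Fin Q) (t : Fin n) :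
    blocksOf Q n K c j t = c (finProdFinEquiv (j, t)) := by
  simp [blocksOf]

/-- The stream of block `j`. [folklore] -/
theorem coinBlockStream_block {Q n K : ℕ} (c : Fin (Q * n) → Fin K) (j : Fin Q) {t : ℕ} (ht : t < n) :
    coinBlockStream c ((j : ℕ) * n + t) = coinBlockStream (blocksOf Q n K c j) t := by
  unfold coinBlockStream
  have hj := j.2
  have hlt : (j : ℕ) * n + t < Q * n := by
    calc (j : ℕ) * n + t < (j : ℕ) * n + n := by omega
      _ = ((j : ℕ) + 1) * n := by ring
      _ ≤ Q * n := Nat.mul_le_mul_right _ hj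
  rw [dif_pos hlt, dif_pos ht, blocksOf_apply]
  congr 2
  exact Fin.ext (by simp [finProdFinEquiv_apply_val]; ring)

/-- **Repetition amplification** (`card_exists_mem_ge` on blocks): if at least `θ K^n` blocks are good,
then at least `(1 - (1 - θ)^Q) K^{Q n}` coin vectors of `Q` blocks have a good block. [folklore] -/
theorem card_exists_block_ge {Q n K : ℕ} (S : Finset (Fin n → Fin K)) {θ : ℝ} (hθ : θ * (K : ℝ) ^ n ≤ #S) :
    (1 - (1 - θ) ^ Q) * ((K : ℝ) ^ n) ^ Q ≤
      #{c : Fin (Q * n) → Fin K | ∃ j : Fin Q, blocksOf Q n K c j ∈ S} := by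
  classical
  have hα : (Fintype.card (Fin n → Fin K) : ℝ) = (K : ℝ) ^ n := by simp
  have h := card_exists_mem_ge S Q (θ := θ) (by rw [hα]; exact hθ)
  rw [hα] at h
  have hcard : #{c : Fin (Q * n) → Fin K | ∃ j : Fin Q, blocksOf Q n K c j ∈ S} =
      #{f : Fin Q → Fin n → Fin K | ∃ j, f j ∈ S} :=
    Finset.card_equiv (blocksOf Q n K) fun c => by simp
  rw [hcard]; exact h

/-! ### One block -/

variable (w) in
/-- The value of a repetition run on the coin block `β`. [cite: Pratt2024SCC, §2 (proof of Thm. 1.9)] -/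
def repVb (T : RepTables) (Lay : RepLayout) (β : Fin Lay.coins → Fin (2 ^ w)) : ℕ :=
  SProg.repV w T Lay (coinBlockStream β) (fun t => coinBlockStream β (Lay.M - 1 + t))

/-- **The block count.** Let `G` be a set of permutations of `[M]` such that whenever the shuffle of
the prefix lands in `G`, a good triple exists. Then at least
`(#G / M!) · (1 - M²/2^w) · (13/16) · (2^w)^{coins}` coin blocks give a non-zero value
(`card_filter_fisherYates_mem_ge`, `card_suffix_ge`, `repV_ne_zero_of_form_ne_zero`).
[cite: Pratt2024SCC, §2 (proof of Thm. 1.9)] -/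
theorem card_block_ge (T : RepTables) (Lay : RepLayout) {k m D : ℕ} (UVW : ℕ → ℕ → ℕ → ℤ)
    (hN : Lay.N = prattC k ^ m) (hR : 1 ≤ Lay.R) (hr : Lay.r = Lay.q * m)
    (hUc : ∀ l i d, l < 3 → i < Lay.R → d < Lay.N →
      (T.Uc l i d : ZMod (2 ^ w)) = (UVW l i d : ZMod (2 ^ w)))
    (hdec : ∀ d e f, ∑ i ∈ range Lay.R, UVW 0 i d * UVW 1 i e * UVW 2 i f =
      if ∀ t, t < m → DigitDisjoint k t d e f then (D : ℤ) ^ 3 else 0)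
    (hD : 0 < D) (hfit : 15 ^ 3 * Lay.Ntot ^ 3 * (D ^ 3) ^ Lay.q < 2 ^ w)
    (hFt1 : ∀ l a, l < 3 → a < Lay.MB → T.Ft l a ≤ 1) (hMB : Lay.MB = 2 ^ Lay.M)
    (hrtk : Lay.r * Lay.tk = Lay.M) (hC : 1 ≤ Lay.C) (hBM1 : ∀ j i, j < Lay.C → i < Lay.tk → T.BM j i ≤ 1)
    (hw : 4 ≤ w) (hM : 1 ≤ Lay.M) (hMw : Lay.M ≤ 2 ^ w)
    (G : Finset (Equiv.Perm (Fin Lay.M)))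
    (hlink : ∀ ρ : Fin (Lay.M - 1) → Fin (2 ^ w), fisherYates Lay.M (coinBlockStream ρ) ∈ G →
      ∃ a b c, a < Lay.Ntot ∧ b < Lay.Ntot ∧ c < Lay.Ntot ∧
        GoodTriple k T Lay (SProg.gOf Lay.M (coinBlockStream ρ)) a b c) :
    (#G : ℝ) / (Lay.M).factorial * (1 - (Lay.M : ℝ) ^ 2 / 2 ^ w) * (13 / 16) * ((2 : ℝ) ^ w) ^ Lay.coins ≤
      #{β : Fin Lay.coins → Fin (2 ^ w) | repVb w T Lay β ≠ 0} := by
  classical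
  -- membership bits are 0/1 for every shuffle
  have hm1 : ∀ (cs : ℕ → ℕ) (l a : ℕ), l < 3 → membOf T Lay (SProg.gOf Lay.M cs) l a ≤ 1 :=
    fun cs l a hl => membOf_le_one hFt1 hMB (fun p hp => SProg.gOf_lt cs hp)
      (fun p p' hp hp' h => SProg.gOf_inj cs hp hp' h) hrtk hC hBM1 hl a
  -- the prefix/suffix count in `ℕ`
  have hnat := card_prefix_mul_le (m := Lay.M - 1) (n := 3 * Lay.Ntot) (K := 2 ^ w)
    (P := fun β => repVb w T Lay β ≠ 0)
    (A := fun ρ => fisherYates Lay.M (coinBlockStream ρ) ∈ G)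
    (B := fun ρ σ => trilinearForm Lay.Ntot (GoodTriple k T Lay (SProg.gOf Lay.M (coinBlockStream ρ)))
      (valOf (coinBlockStream σ) 0) (valOf (coinBlockStream σ) 1) (valOf (coinBlockStream σ) 2) ≠ 0)
    (b := 13 * (2 ^ w) ^ (3 * Lay.Ntot)) (d := 16) ?_ ?_
  rotate_left
  · -- `P` from `A` and `B`
    intro β _ hB
    have heq : repVb w T Lay β = SProg.repV w T Lay (coinBlockStream (splitVec (Lay.M - 1) (3 * Lay.Ntot) (2 ^ w) β).1)
        (coinBlockStream (splitVec (Lay.M - 1) (3 * Lay.Ntot) (2 ^ w) β).2) := by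
      unfold repVb
      exact repV_congr T Lay hR (fun t ht => coinBlockStream_split_fst β ht)
        (fun t ht => coinBlockStream_split_snd β ht)
    rw [heq]
    exact repV_ne_zero_of_form_ne_zero T Lay _ _ UVW hN hR hr hUc hdec (hm1 _) hD hB hfit
  · -- the suffix count
    intro ρ hρ
    obtain ⟨a, b, c, ha, hb, hc, hg⟩ := hlink ρ hρ
    exact card_suffix_ge Lay.Ntot _ ha hb hc hg hw
  -- the prefix count in `ℝ`
  have hfy := card_filter_fisherYates_mem_ge (M := 2 ^ w) hM hMw G
  have hcoins : ∀ ρ : Fin (Lay.M - 1) → Fin (2 ^ w), coins ρ = coinBlockStream ρ := fun ρ => rfl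
  simp only [hcoins] at hfy
  -- combine
  have hnatR : (#{ρ : Fin (Lay.M - 1) → Fin (2 ^ w) | fisherYates Lay.M (coinBlockStream ρ) ∈ G} : ℝ) *
      (13 * ((2 : ℝ) ^ w) ^ (3 * Lay.Ntot)) ≤ 16 * #{β : Fin Lay.coins → Fin (2 ^ w) | repVb w T Lay β ≠ 0} := by
    have := hnat
    exact_mod_cast this
  have hpos : (0 : ℝ) ≤ 13 * ((2 : ℝ) ^ w) ^ (3 * Lay.Ntot) := by positivity
  have hX : ((2 : ℝ) ^ w) ^ Lay.coins = ((2 : ℝ) ^ w) ^ (Lay.M - 1) * ((2 : ℝ) ^ w) ^ (3 * Lay.Ntot) := by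
    rw [← pow_add]; rfl
  push_cast at hfy
  have key := (mul_le_mul_of_nonneg_right hfy hpos).trans hnatR
  calc (#G : ℝ) / (Lay.M).factorial * (1 - (Lay.M : ℝ) ^ 2 / 2 ^ w) * (13 / 16) * ((2 : ℝ) ^ w) ^ Lay.coins
      = (#G : ℝ) / (Lay.M).factorial * (1 - (Lay.M : ℝ) ^ 2 / 2 ^ w) * ((2 : ℝ) ^ w) ^ (Lay.M - 1) *
          (13 * ((2 : ℝ) ^ w) ^ (3 * Lay.Ntot)) / 16 := by rw [hX]; ring
    _ ≤ 16 * (#{β : Fin Lay.coins → Fin (2 ^ w) | repVb w T Lay β ≠ 0} : ℝ) / 16 :=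
        div_le_div_of_nonneg_right key (by norm_num)
    _ = _ := by ring

/-- **The success count of the repetitions.** If the block bound `θ (2^w)^{coins} ≤ #{good blocks}`
holds with `θ ≤ 1` and `θ Q ≥ 2`, then at least `2/3` of all coin vectors of `Q` blocks contain a block
with a non-zero value (`card_exists_block_ge`, `one_sub_pow_le_third`). [cite: Pratt2024SCC, §2 (proof of Thm. 1.9)] -/
theorem card_good_ge_two_thirds (T : RepTables) (Lay : RepLayout) (Q : ℕ) {θ : ℝ}
    (hθ : θ * ((2 : ℝ) ^ w) ^ Lay.coins ≤ #{β : Fin Lay.coins → Fin (2 ^ w) | repVb w T Lay β ≠ 0})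
    (hθ1 : θ ≤ 1) (hθQ : 2 ≤ θ * Q) :
    2 / 3 * ((2 : ℝ) ^ w) ^ (Q * Lay.coins) ≤
      #{c : Fin (Q * Lay.coins) → Fin (2 ^ w) | ∃ j : Fin Q, repVb w T Lay (blocksOf Q Lay.coins (2 ^ w) c j) ≠ 0} := by
  classical
  have h := card_exists_block_ge (Q := Q) ({β : Fin Lay.coins → Fin (2 ^ w) | repVb w T Lay β ≠ 0} : Finset _)
    (θ := θ) (by push_cast; exact hθ)
  have h3 := one_sub_pow_le_third hθ1 hθQ
  have hpow : ((2 : ℝ) ^ w) ^ (Q * Lay.coins) = (((2 : ℝ) ^ w) ^ Lay.coins) ^ Q := by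
    rw [show Q * Lay.coins = Lay.coins * Q from Nat.mul_comm _ _, pow_mul]
  have hS : ∀ c : Fin (Q * Lay.coins) → Fin (2 ^ w),
      (∃ j : Fin Q, blocksOf Q Lay.coins (2 ^ w) c j ∈ ({β : Fin Lay.coins → Fin (2 ^ w) | repVb w T Lay β ≠ 0} : Finset _)) ↔
      ∃ j : Fin Q, repVb w T Lay (blocksOf Q Lay.coins (2 ^ w) c j) ≠ 0 := fun c => by simp
  simp only [hS] at h
  push_cast at h
  rw [hpow]
  have hnn : (0 : ℝ) ≤ (((2 : ℝ) ^ w) ^ Lay.coins) ^ Q := by positivity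
  have h23 : (2 : ℝ) / 3 ≤ 1 - (1 - θ) ^ Q := by linarith
  exact (mul_le_mul_of_nonneg_right h23 hnn).trans h

end Counting

end Literature.Computability.AlgebraicComplexity
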